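import Summits.RiemannHypothesis.RiemannHypothesis.Theorems.OddSectorOddOneSignedWindowsExistence
import Summits.RiemannHypothesis.RiemannHypothesis.Theorems.OddSectorOddOneSignedWindowsRealPart
import Summits.RiemannHypothesis.RiemannHypothesis.Theorems.OddSectorOddOneSignedWindowsEulerLagrange
import Summits.RiemannHypothesis.RiemannHypothesis.Theorems.WeilGroundStateGroundStateSimpleEvenStubIntertwineContinuity
import HarnessLib

/-!
# The weak Euler–Lagrange equation of an odd-sector ground state holds along EVERY approximating
# sequence (helper for crux `OddSector.OddOneSignedWindows`, item stmt-RiemannHypothesis-17778; RH-free)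

`Theorems/OddSectorOddOneSignedWindowsEulerLagrange.lean` proves Bombieri's variational equation
for an operator-free odd-sector ground state `u` (`IsWeilOddGroundState a u`) in weak form along
SOME odd minimising sequence `gₙ → u`: `W(gₙ ⋆ h̃) → ε_od(a) ∫ u h̄` for every window test `h`.
Sign analyses of `u` want to test the equation along approximating sequences of their own
choosing (mollifications of `u`, truncations, positive/negative parts smoothed, …). This file
removes the dependence on the sequence: by the `L²`-continuity of `f ↦ W(f ⋆ h̃)` on window test
functions (`GroundStateSimpleEven.exists_norm_weilFunctional_weilConv_le_sqrt`, via
`GroundStateSimpleEven.tendsto_weilFunctional_weilConv_of_tendsto_sub`, route WeilGroundState,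
reused), EVERY sequence of window test functions `Pₙ → u` in `L²` — of any parity, minimising
or not — satisfies `W(Pₙ ⋆ h̃) → ε_od(a) ∫ u h̄`
(`IsWeilOddGroundState.tendsto_weilFunctional_weilConv`). In particular the limit functional
`h ↦ lim W(Pₙ ⋆ h̃)` is an invariant of `u` (`IsWeilOddGroundState.lim_weilFunctional_weilConv_eq`).

Also recorded here (it needs both companion files, which elaborate independently of each other):
every window `a > 0` carries a REAL-VALUED odd-sector ground state
(`exists_isWeilOddGroundState_real` = `exists_isWeilOddGroundState` + `exists_real_of_isWeilOddGroundState`),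
so that the crux `OddOneSignedWindows` is literally the one-signedness, on an unbounded set of
windows, of one of these real odd ground states (`oddOneSignedWindows_of_real_oneSigned`).

References: E. Bombieri, Rend. Lincei (9) 11 (2000), §4 Lemma 1 / (4.2); the continuity estimate
is Bombieri's §4 Lemma 3 (the three terms of `T` are bounded on `L²(E)`).
-/

noncomputable section

set_option linter.dupNamespace false

open scoped Topology Real ComplexConjugate
open Filter Set MeasureTheory Complex

namespace Summit.RiemannHypothesis.RiemannHypothesis.Theorems.OddSector

open Literature.NumberTheory.LFunctions
open Summit.RiemannHypothesis.RiemannHypothesis.Theorems.GroundStateSimpleEven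

/-- **Weak Euler–Lagrange equation of an odd-sector ground state along EVERY approximating
sequence.** Let `u` be an odd-sector ground state at the window `a` and let `Pₙ` be test
functions supported in `[-a, a]` (any parity) with `∫|Pₙ − u|² → 0`. Then for every test
function `h` supported in `[-a, a]`, `W(Pₙ ⋆ h̃) → ε_od(a) ∫ u h̄`. Proof: along the odd
minimising sequence `gₙ` of `IsWeilOddGroundState.exists_eulerLagrange` the limit is
`ε_od(a)⟨u, h⟩`; `∫|gₙ − Pₙ|² → 0` (common `L²`-limit), and limits of `W(· ⋆ h̃)` transfer
between `L²`-close sequences of window tests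
(`GroundStateSimpleEven.tendsto_weilFunctional_weilConv_of_tendsto_sub`).
[cite: Bombieri2000Weil, §4 Lemma 1 / (4.2) and Lemma 3] -/
theorem _root_.Literature.NumberTheory.LFunctions.IsWeilOddGroundState.tendsto_weilFunctional_weilConv
    {a : ℝ} {u : ℝ → ℂ} (hu : IsWeilOddGroundState a u) {P : ℕ → ℝ → ℂ}
    (hP : ∀ n, IsWeilTest (P n) ∧ tsupport (P n) ⊆ Icc (-a) a)
    (hPL : Tendsto (fun n ↦ ∫ t, ‖P n t - u t‖ ^ 2) atTop (𝓝 0))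
    {h : ℝ → ℂ} (hh : IsWeilTest h) (hhs : tsupport h ⊆ Icc (-a) a) :
    Tendsto (fun n ↦ weilFunctional (weilConv (P n) (weilReflect h))) atTop
      (𝓝 ((weilOddGroundEnergy a : ℂ) * ∫ t, u t * conj (h t))) := by
  obtain ⟨g, hg, -, hgL, hEL⟩ := hu.exists_eulerLagrange
  have ha : 0 < a := hu.pos
  -- `∫|gₙ − Pₙ|² → 0` from the common limit `u`
  have hclose : Tendsto (fun n ↦ ∫ t, ‖g n t - P n t‖ ^ 2) atTop (𝓝 0) :=
    tendsto_integral_norm_sq_sub_of_common_limit hu.memLp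
      (fun n ↦ ConnesVanSuijlekom.isWeilTest_memLp (hg n).1)
      (fun n ↦ ConnesVanSuijlekom.isWeilTest_memLp (hP n).1) hgL hPL
  exact tendsto_weilFunctional_weilConv_of_tendsto_sub ha hh (fun n ↦ ⟨(hg n).1, (hg n).2.1⟩)
    hP hclose (hEL h hh hhs)

/-- **The weak Euler–Lagrange limit is an invariant of the ground state**: for two sequences of
window test functions `Pₙ → u`, `P'ₙ → u` in `L²` and any window test `h`, if `W(Pₙ ⋆ h̃) → L`
then `L = ε_od(a) ∫ u h̄` — in particular the limit does not depend on the sequence. [folklore] -/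
theorem _root_.Literature.NumberTheory.LFunctions.IsWeilOddGroundState.lim_weilFunctional_weilConv_eq
    {a : ℝ} {u : ℝ → ℂ} (hu : IsWeilOddGroundState a u) {P : ℕ → ℝ → ℂ}
    (hP : ∀ n, IsWeilTest (P n) ∧ tsupport (P n) ⊆ Icc (-a) a)
    (hPL : Tendsto (fun n ↦ ∫ t, ‖P n t - u t‖ ^ 2) atTop (𝓝 0))
    {h : ℝ → ℂ} (hh : IsWeilTest h) (hhs : tsupport h ⊆ Icc (-a) a) {L : ℂ}
    (hL : Tendsto (fun n ↦ weilFunctional (weilConv (P n) (weilReflect h))) atTop (𝓝 L)) :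
    L = (weilOddGroundEnergy a : ℂ) * ∫ t, u t * conj (h t) :=
  tendsto_nhds_unique hL (hu.tendsto_weilFunctional_weilConv hP hPL hh hhs)

/-- **Real odd-sector ground states exist at every window**: for `a > 0` there is a real-valued
`v` with `IsWeilOddGroundState a v` (`exists_isWeilOddGroundState`, then
`exists_real_of_isWeilOddGroundState`). Together with `oddOneSignedWindows_of_real_oneSigned`
this leaves of the crux exactly the SIGN question for such `v` on `(0, a)`. [folklore] -/
theorem exists_isWeilOddGroundState_real {a : ℝ} (ha : 0 < a) :
    ∃ v : ℝ → ℂ, IsWeilOddGroundState a v ∧ ∀ t, (v t).im = 0 := by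
  obtain ⟨u, hu⟩ := exists_isWeilOddGroundState ha
  exact exists_real_of_isWeilOddGroundState hu

/-- Beyond every height there is a window carrying a real-valued odd-sector ground state (the
crux `OddOneSignedWindows` with its sign clause removed but its reality clause kept). [folklore] -/
theorem exists_isWeilOddGroundState_real_unbounded (A : ℝ) :
    ∃ a : ℝ, A ≤ a ∧ ∃ v : ℝ → ℂ, IsWeilOddGroundState a v ∧ ∀ t, (v t).im = 0 := by
  obtain ⟨v, hv⟩ := exists_isWeilOddGroundState_real (lt_max_of_lt_right one_pos : (0 : ℝ) < max A 1)
  exact ⟨max A 1, le_max_left _ _, v, hv⟩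

end Summit.RiemannHypothesis.RiemannHypothesis.Theorems.OddSector

end
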